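import Literature.MathematicalPhysics.QuantumFieldTheory.WilsonFinTorusTwistedPartitionDomination
import Literature.MathematicalPhysics.QuantumFieldTheory.WilsonFinTorusMagneticFluxSectors
import HarnessLib

/-!
# Temporal twist costs of the Wilson box are SUB-ADDITIVE within the temporal star ('t Hooft flux positivity); single temporal planes
# control every temporal twist tensor (constant 10)

Helper for crux `IRcof` (stmt-QuantumFields-26930), N_cof ∕ (CU)-type side — §1 (currency) + §1b (PROVED block) of ideator ym-ir-idea-23 g0's LINE 1
rev 2 «meso-vortex-spreading» (`Cruxes/IRcof/Lines/meso_vortex_spreading.lean`, crux write e5280908fc56; the ideator's LAND-ASK 20:39:09Z, conditional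
on the critic's KEY), extracted VERBATIM by the custody LEAD ym-ir-line-ab-p1 g7 under the LEAD LANE PROTOCOL (pub/ym-ir/STATUS 16:38:18Z (b));
mathematics unchanged (gate-forced only: five one-line docstrings added on `eTwist_center` ∕ `zHom_zero` ∕ `zHom_add` ∕ `zHom_castSucc_mem_center` ∕ `zHom_single`); namespace moved to `…Cruxes.IRcof.TemporalTwistSubadditivity` (no FQN clash with the Lines module, which keeps its copy until re-cut).

CONTENT (valid for EVERY compact group `G`, continuous unitary `ρ`, `β ≥ 0`; no simplicity, no floor, no unit map):
* §1 currency: `magTwist`, `eTwist` (+ `eTwist_center`), `projZ`, `projDefect` — magnetic slab twists, electric twists `z^{k_μ}` in the temporal planes,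
  the e-projected partition function of the cold box and its defect (definitions of the Lines module, verbatim).
* §1b-A: `one_sub_re_mul_le` (unimodular `1 − Re(ab) ≤ 2(1 − Re a) + 2(1 − Re b)`), `addChar_normSq_eq_one`, ★ `pd_defect_subadditive` — a real function on a
  finite abelian group with non-negative Fourier coefficients has sub-additive defect `f 0 − f (x+y) ≤ 2(f 0 − f x) + 2(f 0 − f y)`.
* §1b-B: ★ `temporalTwistCost_subadditive` — for the Wilson box `b₁×b₂×b₃×(M+2)` at ANY magnetic background, the cost `W{0} − W{·}` of central temporal
  twists drawn from a finite abelian family is sub-additive (flux positivity `wilsonFinTorusMagneticFluxPartition_nonneg` + Fourier inversion ⇒ positive-definite).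
* §1b-C: `zVec` ∕ `zHom` (+ algebra), ★★ `temporalTensorCost_le_of_single` — if every SINGLE temporal plane twist `z^{e_μ}` costs `≤ θ·Z`, every temporal
  tensor `(z^{k₀}, z^{k₁}, z^{k₂})` costs `≤ 10·θ·Z`; `eTwist_eq_elecMag`.

Reusable by (CU)-type lines (rows 21 ∕ 42 ∕ 43 ∕ 48 of `pub/ym-ir/REDUCTION-CENSUS.md`: a regime for single temporal planes gives the regime for all temporal
tensors).  HONEST FRAMING: group-blind partition-function bookkeeping (width 0); nothing here proves N_cof, PXcof, `IRcof`, `IR`, or the Clay Yang–Mills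
mass gap (NOT proved anywhere in this tree; R4 = the conditional finite-𝕋⁴ rung `BalabanLadder.UV` only).  Attribution: ym-ir-idea-23 g0 (author).
-/

set_option autoImplicit false

noncomputable section

open Filter Topology MeasureTheory
open scoped BigOperators ComplexConjugate
open Literature.MathematicalPhysics.QuantumFieldTheory Literature.MathematicalPhysics.QuantumLattice

namespace Summit.QuantumFields.YangMills.Cruxes.IRcof.TemporalTwistSubadditivity

/-! ## §1 Currency: magnetic slab twists and the e-projected cold box -/

section Defs

variable {G : Type} [Group G] [TopologicalSpace G] [IsTopologicalGroup G] [CompactSpace G]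
  [MeasurableSpace G] [BorelSpace G]

/-- **Magnetic slab twist**: 't Hooft twist `w` on the plane `(0,1)` — the two TRANSVERSE directions of the slab `(ℓ, ℓ, L, t)` — and no
other twist (magnetic flux along the long direction `2`, the twisted stack spanning `(2,3)`, area `L × t`). -/
def magTwist (w : G) : Fin 4 → Fin 4 → G :=
  fun μ ν => if μ = 0 ∧ ν = 1 then w else 1

/-- **The temporal twist family of the e-projection**: central `z`, exponents `k : Fin 3 → Fin n`; the tensor twists the plane `(μ, 3)`
(`μ = 0,1,2` spatial, `3` = Euclidean time) by `z ^ k μ` ('t Hooft's `n_{μ3} = k_μ`). -/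
def eTwist (z : G) {n : ℕ} (k : Fin 3 → Fin n) : Fin 4 → Fin 4 → G :=
  fun μ ν => if h : μ.val < 3 ∧ ν = 3 then z ^ ((k ⟨μ.val, h.1⟩ : Fin n) : ℕ) else 1

/-- **The e-projected cold-box partition function** `P_β(L; t) := n⁻³ Σ_{k ∈ (Fin n)³} W{n_{μ3} = k_μ}(L,L,L,t)`: for `z` of order `n`
generating the centre of `SU(N)` this is the trace of `𝒯^t` over the ZERO ELECTRIC FLUX sector `e = 0` ('t Hooft 1979 (5.2)–(5.4));
for general central `z`, `z^n = 1`, the projection onto the fluxes annihilated by `z`.  Real: a finite average of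
`wilsonFinTorusTensorTwistedPartition`s. -/
def projZ {N : ℕ} (ρ : G →* Matrix (Fin N) (Fin N) ℂ) (β : ℝ) (z : G) (n : ℕ) (L t : ℕ) : ℝ :=
  ((Fintype.card (Fin 3 → Fin n) : ℕ) : ℝ)⁻¹ * ∑ k : Fin 3 → Fin n, wilsonFinTorusTensorTwistedPartition ρ β (eTwist z k) L L L t

/-- **The e-projected purity defect** of the cold box at period `t ↦ 2t`: `1 − P(L; 2t) / P(L; t)²` (`= 1 − tr ϱ²` of the normalised
flux-free thermal state when `z` generates the centre). -/
def projDefect {N : ℕ} (ρ : G →* Matrix (Fin N) (Fin N) ℂ) (β : ℝ) (z : G) (n : ℕ) (L t : ℕ) : ℝ :=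
  1 - projZ ρ β z n L (2 * t) / projZ ρ β z n L t ^ 2

omit [TopologicalSpace G] [IsTopologicalGroup G] [CompactSpace G] [MeasurableSpace G] [BorelSpace G] in
/-- The electric twist family `eTwist z k` of a central `z` is central in every plane. -/
theorem eTwist_center {z : G} (hz : z ∈ Subgroup.center G) {n : ℕ} (k : Fin 3 → Fin n) (μ ν : Fin 4) :
    eTwist z k μ ν ∈ Subgroup.center G := by
  unfold eTwist
  split_ifs
  · exact Subgroup.pow_mem _ hz _
  · exact Subgroup.one_mem _

end Defs

/-! ## §1b Within-star sub-additivity of temporal twist costs — PROVED from 't Hooft flux positivity (rev 2) -/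

section StarSubadditivity

/-! ### §1b-A. Positive-definite functions on a finite abelian group are sub-additive in their defect -/

/-- For unimodular `a b : ℂ`: `1 − Re(ab) ≤ 2(1 − Re a) + 2(1 − Re b)`. -/
theorem one_sub_re_mul_le {a b : ℂ} (ha : Complex.normSq a = 1) (hb : Complex.normSq b = 1) :
    1 - (a * b).re ≤ 2 * (1 - a.re) + 2 * (1 - b.re) := by
  rw [Complex.normSq_apply] at ha hb
  rw [Complex.mul_re]
  have ha1 : a.re ≤ 1 := by nlinarith [sq_nonneg a.im]
  have hb1 : b.re ≤ 1 := by nlinarith [sq_nonneg b.im]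
  nlinarith [mul_nonneg (sub_nonneg.2 ha1) (sub_nonneg.2 hb1), sq_nonneg (a.im - b.im),
    sq_nonneg (1 - a.re), sq_nonneg (1 - b.re)]

variable {Γ : Type*} [AddCommGroup Γ] [Fintype Γ]

/-- Characters of a finite abelian group are unimodular. -/
theorem addChar_normSq_eq_one (ψ : AddChar Γ ℂ) (x : Γ) : Complex.normSq (ψ x) = 1 := by
  have h : ((Complex.normSq (ψ x) : ℝ) : ℂ) = 1 := by
    rw [Complex.normSq_eq_conj_mul_self, ← AddChar.map_neg_eq_conj, ← AddChar.map_add_eq_mul, neg_add_cancel,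
      AddChar.map_zero_eq_one]
  exact_mod_cast h

/-- **Sub-additivity of the defect of a positive-definite function**: if `f : Γ → ℝ` has non-negative Fourier coefficients
`c ψ ≥ 0` (`f k = Σ_ψ ψ(k) c_ψ`), then `f 0 − f (x+y) ≤ 2(f 0 − f x) + 2(f 0 − f y)`. -/
theorem pd_defect_subadditive (c : AddChar Γ ℂ → ℝ) (hc : ∀ ψ, 0 ≤ c ψ) (f : Γ → ℝ)
    (hf : ∀ k, (f k : ℂ) = ∑ ψ : AddChar Γ ℂ, ψ k * (c ψ : ℂ)) (x y : Γ) :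
    f 0 - f (x + y) ≤ 2 * (f 0 - f x) + 2 * (f 0 - f y) := by
  have hre : ∀ k, f k = ∑ ψ : AddChar Γ ℂ, (ψ k).re * c ψ := fun k => by
    have h := congrArg Complex.re (hf k)
    simpa [Complex.re_sum, Complex.mul_re] using h
  have h0 : ∀ ψ : AddChar Γ ℂ, (ψ (0 : Γ)).re = 1 := fun ψ => by
    rw [AddChar.map_zero_eq_one]; simp
  have hg : ∀ k, f 0 - f k = ∑ ψ : AddChar Γ ℂ, (1 - (ψ k).re) * c ψ := fun k => by
    rw [hre 0, hre k, ← Finset.sum_sub_distrib]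
    exact Finset.sum_congr rfl fun ψ _ => by rw [h0]; ring
  have key : ∀ ψ : AddChar Γ ℂ,
      (1 - (ψ (x + y)).re) * c ψ ≤ (2 * (1 - (ψ x).re) + 2 * (1 - (ψ y).re)) * c ψ := fun ψ => by
    refine mul_le_mul_of_nonneg_right ?_ (hc ψ)
    rw [AddChar.map_add_eq_mul]
    exact one_sub_re_mul_le (addChar_normSq_eq_one ψ x) (addChar_normSq_eq_one ψ y)
  rw [hg, hg, hg]
  calc ∑ ψ : AddChar Γ ℂ, (1 - (ψ (x + y)).re) * c ψ
      ≤ ∑ ψ : AddChar Γ ℂ, (2 * (1 - (ψ x).re) + 2 * (1 - (ψ y).re)) * c ψ := Finset.sum_le_sum fun ψ _ => key ψ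
    _ = 2 * ∑ ψ : AddChar Γ ℂ, (1 - (ψ x).re) * c ψ + 2 * ∑ ψ : AddChar Γ ℂ, (1 - (ψ y).re) * c ψ := by
        rw [Finset.mul_sum, Finset.mul_sum, ← Finset.sum_add_distrib]
        exact Finset.sum_congr rfl fun ψ _ => by ring

/-! ### §1b-B. The Wilson box: temporal twist costs at a fixed magnetic background are sub-additive within the temporal star -/

variable {G : Type} [Group G] [TopologicalSpace G] [IsTopologicalGroup G] [CompactSpace G]
  [MeasurableSpace G] [BorelSpace G] [SecondCountableTopology G] {N : ℕ} (ρ : G →* Matrix (Fin N) (Fin N) ℂ)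

/-- ★ **Within-star sub-additivity of temporal twist costs** (from 't Hooft flux positivity, tree
`wilsonFinTorusMagneticFluxPartition_nonneg`, and Fourier inversion `sum_apply_mul_wilsonFinTorusMagneticFluxPartition`):
for `β ≥ 0`, continuous unitary `ρ`, any magnetic background `zM`, any finite abelian group `Γ` of central temporal twists `φ`,
and the box `b₁ × b₂ × b₃ × (M+2)`:
`W{φ 0} − W{φ(x+y)} ≤ 2 (W{φ 0} − W{φ x}) + 2 (W{φ 0} − W{φ y})`. -/
theorem temporalTwistCost_subadditive (hρ : Continuous ρ) (hρu : ∀ g, ρ g ∈ Matrix.unitaryGroup (Fin N) ℂ)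
    {β : ℝ} (hβ : 0 ≤ β) (zM : Fin 4 → Fin 4 → G) {φ : Γ → Fin 4 → G} (hφ0 : φ 0 = 1)
    (hφadd : ∀ k k', φ (k + k') = φ k * φ k') (hφc : ∀ k (i : Fin 3), φ k i.castSucc ∈ Subgroup.center G)
    (b₁ b₂ b₃ M : ℕ) (x y : Γ) :
    wilsonFinTorusTensorTwistedPartition ρ β (elecMagTwistTensor (φ 0) zM) b₁ b₂ b₃ (M + 2) -
        wilsonFinTorusTensorTwistedPartition ρ β (elecMagTwistTensor (φ (x + y)) zM) b₁ b₂ b₃ (M + 2) ≤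
      2 * (wilsonFinTorusTensorTwistedPartition ρ β (elecMagTwistTensor (φ 0) zM) b₁ b₂ b₃ (M + 2) -
          wilsonFinTorusTensorTwistedPartition ρ β (elecMagTwistTensor (φ x) zM) b₁ b₂ b₃ (M + 2)) +
      2 * (wilsonFinTorusTensorTwistedPartition ρ β (elecMagTwistTensor (φ 0) zM) b₁ b₂ b₃ (M + 2) -
          wilsonFinTorusTensorTwistedPartition ρ β (elecMagTwistTensor (φ y) zM) b₁ b₂ b₃ (M + 2)) := by
  refine pd_defect_subadditive
    (fun ψ => (wilsonFinTorusMagneticFluxPartition ρ β zM φ ψ b₁ b₂ b₃ (M + 2)).re)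
    (fun ψ => (wilsonFinTorusMagneticFluxPartition_nonneg ρ hρ hρu hβ zM hφ0 hφadd hφc ψ b₁ b₂ b₃ M).1)
    (fun k => wilsonFinTorusTensorTwistedPartition ρ β (elecMagTwistTensor (φ k) zM) b₁ b₂ b₃ (M + 2))
    (fun k => ?_) x y
  rw [← sum_apply_mul_wilsonFinTorusMagneticFluxPartition ρ β zM φ b₁ b₂ b₃ (M + 2) k]
  refine Finset.sum_congr rfl fun ψ _ => ?_
  have him := (wilsonFinTorusMagneticFluxPartition_nonneg ρ hρ hρu hβ zM hφ0 hφadd hφc ψ b₁ b₂ b₃ M).2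
  congr 1
  exact Complex.ext (by simp) (by simp [him])

/-! ### §1b-C. Powers of one central element: the temporal family `z^{e_μ}` -/

omit [TopologicalSpace G] [IsTopologicalGroup G] [CompactSpace G] [MeasurableSpace G] [BorelSpace G]
  [SecondCountableTopology G] in
/-- `z ^ m = z ^ (m % n)` when `z ^ n = 1`. -/
theorem pow_eq_pow_mod_of_pow_eq_one {z : G} {n : ℕ} (hzn : z ^ n = 1) (m : ℕ) : z ^ m = z ^ (m % n) := by
  conv_lhs => rw [← Nat.div_add_mod m n, pow_add, pow_mul, hzn, one_pow, one_mul]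

/-- The temporal twist vector `(z^{e₀}, z^{e₁}, z^{e₂}, 1)` with natural exponents. -/
def zVec (z : G) (e : Fin 3 → ℕ) : Fin 4 → G :=
  fun μ => if h : μ.val < 3 then z ^ e ⟨μ.val, h⟩ else 1

/-- The twist map `(ZMod n)³ → (Fin 4 → G)`, `κ ↦ (z^{κ₀}, z^{κ₁}, z^{κ₂}, 1)`. -/
def zHom (z : G) (n : ℕ) (κ : Fin 3 → ZMod n) : Fin 4 → G := zVec z (fun i => (κ i).val)

omit [TopologicalSpace G] [IsTopologicalGroup G] [CompactSpace G] [MeasurableSpace G] [BorelSpace G]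
  [SecondCountableTopology G] in
/-- `zHom z n 0 = 1` (the trivial twist). -/
theorem zHom_zero (z : G) (n : ℕ) : zHom z n 0 = 1 := by
  funext μ
  unfold zHom zVec
  split_ifs <;> simp [ZMod.val_zero]

omit [TopologicalSpace G] [IsTopologicalGroup G] [CompactSpace G] [MeasurableSpace G] [BorelSpace G]
  [SecondCountableTopology G] in
/-- `zHom` is additive in the label when `z ^ n = 1`. -/
theorem zHom_add {z : G} {n : ℕ} [NeZero n] (hzn : z ^ n = 1) (κ κ' : Fin 3 → ZMod n) :
    zHom z n (κ + κ') = zHom z n κ * zHom z n κ' := by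
  funext μ
  unfold zHom zVec
  simp only [Pi.mul_apply, Pi.add_apply]
  split_ifs with h
  · rw [ZMod.val_add, ← pow_eq_pow_mod_of_pow_eq_one hzn, pow_add]
  · simp

omit [TopologicalSpace G] [IsTopologicalGroup G] [CompactSpace G] [MeasurableSpace G] [BorelSpace G]
  [SecondCountableTopology G] in
/-- The temporal components of `zHom z n κ` are central when `z` is. -/
theorem zHom_castSucc_mem_center {z : G} (hz : z ∈ Subgroup.center G) (n : ℕ) (κ : Fin 3 → ZMod n) (i : Fin 3) :
    zHom z n κ i.castSucc ∈ Subgroup.center G := by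
  unfold zHom zVec
  split_ifs
  · exact Subgroup.pow_mem _ hz _
  · exact Subgroup.one_mem _

omit [TopologicalSpace G] [IsTopologicalGroup G] [CompactSpace G] [MeasurableSpace G] [BorelSpace G]
  [SecondCountableTopology G] in
/-- In `(ZMod n)³`, the lift of `e : Fin 3 → Fin n` read back through `val` is `e`. -/
theorem zHom_natCast {z : G} {n : ℕ} [NeZero n] (k : Fin 3 → Fin n) :
    zHom z n (fun i => ((k i : ℕ) : ZMod n)) = zVec z (fun i => (k i : ℕ)) := by
  unfold zHom
  congr 1
  funext i
  rw [ZMod.val_natCast, Nat.mod_eq_of_lt (k i).isLt]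

omit [TopologicalSpace G] [IsTopologicalGroup G] [CompactSpace G] [MeasurableSpace G] [BorelSpace G]
  [SecondCountableTopology G] in
/-- `zHom` at a single-coordinate label is the single temporal plane twist `z^{k_μ}`. -/
theorem zHom_single {z : G} {n : ℕ} [NeZero n] (k : Fin 3 → Fin n) (μ : Fin 3) :
    zHom z n (Pi.single μ (((k μ : ℕ) : ZMod n))) = zVec z (Pi.single μ (k μ : ℕ)) := by
  unfold zHom
  congr 1
  funext i
  by_cases hi : i = μ
  · subst hi; simp [ZMod.val_natCast, Nat.mod_eq_of_lt (k i).isLt]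
  · simp [hi, ZMod.val_zero]

/-- ★★ **Single temporal planes control the whole temporal star, constant 10.**  For `β ≥ 0`, continuous unitary `ρ`, a central `z`
with `z ^ n = 1`, `0 < n`, and the box `L × L × L × (M+2)`: if every SINGLE-PLANE temporal twist `z^{e}` in plane `(μ,3)` costs at most
`θ · Z`, then every temporal tensor twist `(z^{k₀}, z^{k₁}, z^{k₂})` costs at most `10 θ · Z`. -/
theorem temporalTensorCost_le_of_single (hρ : Continuous ρ) (hρu : ∀ g, ρ g ∈ Matrix.unitaryGroup (Fin N) ℂ)
    {β : ℝ} (hβ : 0 ≤ β) {z : G} (hz : z ∈ Subgroup.center G) {n : ℕ} (hn : 0 < n) (hzn : z ^ n = 1)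
    (L M : ℕ) {θ : ℝ}
    (hs : ∀ (μ : Fin 3) (e : ℕ), wilsonFinTorusPartition ρ β L L L (M + 2) -
        wilsonFinTorusTensorTwistedPartition ρ β (elecMagTwistTensor (zVec z (Pi.single μ e)) 1) L L L (M + 2) ≤
          θ * wilsonFinTorusPartition ρ β L L L (M + 2))
    (k : Fin 3 → Fin n) :
    wilsonFinTorusPartition ρ β L L L (M + 2) -
        wilsonFinTorusTensorTwistedPartition ρ β (elecMagTwistTensor (zVec z (fun i => (k i : ℕ))) 1) L L L (M + 2) ≤
      10 * θ * wilsonFinTorusPartition ρ β L L L (M + 2) := by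
  haveI : NeZero n := ⟨Nat.pos_iff_ne_zero.mp hn⟩
  -- the group of temporal twist labels and the twist map
  have hφ0 : zHom z n 0 = 1 := zHom_zero z n
  have hφadd : ∀ κ κ' : Fin 3 → ZMod n, zHom z n (κ + κ') = zHom z n κ * zHom z n κ' := zHom_add hzn
  have hφc : ∀ (κ : Fin 3 → ZMod n) (i : Fin 3), zHom z n κ i.castSucc ∈ Subgroup.center G :=
    zHom_castSucc_mem_center hz n
  have sub := fun x y => temporalTwistCost_subadditive ρ hρ hρu hβ (1 : Fin 4 → Fin 4 → G) hφ0 hφadd hφc L L L M x y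
  -- W{φ 0} = Z
  have hZ : wilsonFinTorusTensorTwistedPartition ρ β (elecMagTwistTensor (zHom z n 0) 1) L L L (M + 2) =
      wilsonFinTorusPartition ρ β L L L (M + 2) := by
    rw [hφ0, wilsonFinTorusTensorTwistedPartition_elecMag_one, wilsonFinTorusTwistedPartition_one]
  -- decomposition κ = s₀ + (s₁ + s₂)
  set κ : Fin 3 → ZMod n := fun i => ((k i : ℕ) : ZMod n) with hκ
  have hdec : κ = Pi.single 0 (κ 0) + (Pi.single 1 (κ 1) + Pi.single 2 (κ 2)) := by
    have h := (Finset.univ_sum_single κ).symm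
    rw [Fin.sum_univ_three] at h
    rw [← add_assoc]; exact h
  have hsing : ∀ μ : Fin 3, wilsonFinTorusPartition ρ β L L L (M + 2) -
      wilsonFinTorusTensorTwistedPartition ρ β (elecMagTwistTensor (zHom z n (Pi.single μ (κ μ))) 1) L L L (M + 2) ≤
        θ * wilsonFinTorusPartition ρ β L L L (M + 2) := fun μ => by
    have h := zHom_single (z := z) k μ
    simp only [hκ] at h ⊢
    rw [h]; exact hs μ (k μ)
  have hk : zHom z n κ = zVec z (fun i => (k i : ℕ)) := zHom_natCast k
  rw [← hk, hdec]
  have h1 := sub (Pi.single 0 (κ 0)) (Pi.single 1 (κ 1) + Pi.single 2 (κ 2))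
  have h2 := sub (Pi.single 1 (κ 1)) (Pi.single 2 (κ 2))
  rw [hZ] at h1 h2
  have e0 := hsing 0
  have e1 := hsing 1
  have e2 := hsing 2
  linarith

omit [TopologicalSpace G] [IsTopologicalGroup G] [CompactSpace G] [MeasurableSpace G] [BorelSpace G]
  [SecondCountableTopology G] in
/-- The temporal twist family of the seam is the `zVec` tensor: `eTwist z k = elecMagTwistTensor (z^{k₀}, z^{k₁}, z^{k₂}, 1) 1`. -/
theorem eTwist_eq_elecMag (z : G) {n : ℕ} (k : Fin 3 → Fin n) :
    eTwist z k = elecMagTwistTensor (zVec z (fun i => (k i : ℕ))) (1 : Fin 4 → Fin 4 → G) := by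
  funext μ ν
  unfold eTwist elecMagTwistTensor zVec
  by_cases hν : ν = 3
  · by_cases hμ : μ.val < 3
    · simp [hν, hμ]
    · simp [hν, hμ]
  · simp [hν]

end StarSubadditivity

end Summit.QuantumFields.YangMills.Cruxes.IRcof.TemporalTwistSubadditivity

end
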